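import Mathlib
import HarnessLib
import Summits.ResolutionOfSingularities.ResolutionOfSingularities.Theorems.WildQuotientsWildQuotientResolutionS1aKillClopen
import Summits.ResolutionOfSingularities.ResolutionOfSingularities.Theorems.WildQuotientsWildQuotientResolutionS1aCompCount
import Summits.ResolutionOfSingularities.ResolutionOfSingularities.Theorems.WildQuotientsWildQuotientResolutionS1aSeqRule
import Summits.ResolutionOfSingularities.ResolutionOfSingularities.Theorems.WildQuotientsWildQuotientResolutionS1aKillableReverse

/-!
# S1a — THE ONE-COMPONENT-AT-A-TIME KILL FORM `KillTouchReach p` (weaker than `KillFamilyReach p` by a theorem) and its winning induction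

[OURS · L1 W4.5c · lead-1 g9] — NOT statements of the manuscript; counted 0; AI-level work, weaker than expert review. Crux
stmt-ResolutionOfSingularities-17941, line `s1a-logminvertex` v7 → v8 (lead reshape of the K stub). Route-independent.

WHY. For a principal centre `(𝒦, d)` the trace `badLocus ∩ supp 𝒦_d = badLocus ∩ principalKillOpen` is CLOPEN in the bad locus (`…S1aKillClopen`), so a
principal move that merely TOUCHES the bad locus removes whole connected components of it: the bad locus of the moved model is homeomorphic to
`badLocus ∖ supp 𝒦_d` (`exists_isEmbedding_badLocus_principalMove`: the gen-7 inducing map is an EMBEDDING with RANGE exactly the bad points off the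
support — surjectivity by `isGoodAt_base_of_isGoodAt`, p617035), hence has FEWER irreducible components (`nIrrComp_badLocus_principalMove_lt`). With the
component count as the third component of the lexicographic measure `(jInf, n, nIrrComp badLocus)` the KILL branch of the sequential rule only needs a
principal centre whose support MEETS the bad locus — one connected component of `Z(M)` at a time, each with its own Veronese degree, no disjointness or
simultaneity bookkeeping:
* `KillTouchReach p` (OURS CANDIDATE research statement, asserted nowhere): at every reachable non-terminal model with `jInf = ⊥`, SOME principal centre
  has `(badLocus ∩ supp 𝒦_d).Nonempty`; `killTouchReach_of_killFamilyReach` (the registered v7 stub implies it);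
* ★★ `GameFrame.GModel.wins_of_killTouchOrAuxSeq` — the lexicographic induction on `(jInf, n, nIrrComp badLocus)`;
* `finite_irreducibleComponents_badLocus_of_datum` (models of a datum over a field are quasi-compact).
The `Theses`-cone wrapper (`KillTouchReach p → AuxTopWithinReach p → WinningStrategy p`) is `…S1aWinsOfTouchRule`.
-/

set_option linter.dupNamespace false

noncomputable section

universe u

open CategoryTheory Limits AlgebraicGeometry TopologicalSpace Topology
open Literature.AlgebraicGeometry.Resolution Literature.AlgebraicGeometry.RelativeSpec
open Summit.ResolutionOfSingularities.ResolutionOfSingularities.Theorems.WildQuotientResolution.S1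
open Summit.ResolutionOfSingularities.ResolutionOfSingularities.Theorems.WildQuotientResolution.S1.NodeAtlas
open Summit.ResolutionOfSingularities.ResolutionOfSingularities.Theorems.WildQuotientResolution.S1.BlowupCharts
open Summit.ResolutionOfSingularities.ResolutionOfSingularities.Theorems.WildQuotientResolution.S1.G1Proof
open Summit.ResolutionOfSingularities.ResolutionOfSingularities.Theorems.WildQuotientResolution.S1.KillFamily
open Summit.ResolutionOfSingularities.ResolutionOfSingularities.Theorems.WildQuotientResolution.S1.KillClopen
open Summit.ResolutionOfSingularities.ResolutionOfSingularities.Theorems.WildQuotientResolution.S1.CompCount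
open Summit.ResolutionOfSingularities.ResolutionOfSingularities.Theorems.WildQuotientResolution.S1.KillableTransport
open Summit.ResolutionOfSingularities.ResolutionOfSingularities.Theorems.WildQuotientResolution.S1.KillableReverse

namespace Summit.ResolutionOfSingularities.ResolutionOfSingularities.Theorems.WildQuotientResolution.S1

namespace GameFrame.GModel

variable {p : ℕ} {X' X₁ : Scheme.{0}} {q : X' ⟶ X₁} {G : Type} [Group G] {ρ : G →* Aut X'} {g₀ : G}

/-! ## The bad locus of a principal move IS the part of `Z(M)` off the support -/

/-- ★ **THE BAD LOCUS OF A PRINCIPAL MOVE EMBEDS INTO `Z(M)` WITH RANGE EXACTLY THE BAD POINTS OFF THE SUPPORT** (so `Z(Mʼ) ≃ₜ Z(M) ∖ supp 𝒦_d`):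
the gen-7 inducing map `v' ↦ π' v'` is injective (an isomorphism over the idle region) and every bad point off the support has a bad preimage
(`isGoodAt_base_of_isGoodAt`). [OURS · L1 W4.5c] -/
theorem exists_isEmbedding_badLocus_principalMove [Finite G] (hp : p.Prime) (hG : ∀ g : G, g ∈ Subgroup.zpowers g₀)
    (M M' : GModel p q G ρ g₀) (𝒦 : ReesFiltration M.V) (d : ℕ) (hkill : IsPrincipalCentre p M.act g₀ 𝒦 d)
    (π' : M'.V ⟶ M.V) (hbl : IsBlowup π' (𝒦.ideal d)) (hr : M'.r = π' ≫ M.r)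
    (hcomm : ∀ g : G, (M'.act.aut g).hom ≫ π' = π' ≫ (M.act.aut g).hom)
    {R₀ : Type} [CommRing R₀] [IsNoetherianRing R₀] (s : M.V ⟶ Spec (.of R₀)) [LocallyOfFiniteType s]
    (hs : ∀ g : G, (M.act.aut g).hom ≫ s = s) :
    ∃ φ : ↥M'.badLocus → ↥M.badLocus, IsEmbedding φ ∧ (∀ v', (φ v' : M.V) = π'.base v'.1) ∧
      Set.range φ = {z : ↥M.badLocus | (z : M.V) ∉ ((𝒦.ideal d).support : Set M.V)} := by
  have hmem : ∀ v' : ↥M'.badLocus, π'.base v'.1 ∈ M.badLocus := fun v' =>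
    (mem_badLocus_of_principalMove hp hG M M' 𝒦 d hkill π' hbl hr hcomm s hs v'.2).1
  have hsuppG : ∀ g : G, (M.act.aut g).hom ⁻¹ᵁ (𝒦.ideal d).support.compl = (𝒦.ideal d).support.compl :=
    fun g => preimage_support_compl_of_comap_eq M (fun g => hkill.2.1 g d) g
  -- the idle region `W` = complement of the support, over which `π'` is an isomorphism
  let W : M.V.Opens := (𝒦.ideal d).support.compl
  haveI hiso : IsIso (π' ∣_ W) := hbl.isIso_morphismRestrict (U := W) (by
    rw [Set.disjoint_iff]; rintro x ⟨hx, hx'⟩; exact hx hx')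
  have hW : ∀ v' : ↥M'.badLocus, v'.1 ∈ π' ⁻¹ᵁ W := fun v' => by
    obtain ⟨hbad, hno⟩ := mem_badLocus_of_principalMove hp hG M M' 𝒦 d hkill π' hbl hr hcomm s hs v'.2
    obtain ⟨O, hvO, hO | hO⟩ := hkill.2.2 (π'.base v'.1)
    · exact absurd hvO (hno O hO)
    · change π'.base v'.1 ∈ ((𝒦.ideal d).support : Set M.V)ᶜ
      have hdisj := disjoint_support_of_ideal_eq_top (I := 𝒦.ideal d) hO.1.1
        (by rw [← ReesFiltration.filtration_ideal]; exact hO.2 d)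
      exact Set.disjoint_left.mp hdisj hvO
  -- the embedding: `Z(M') ⊆ π'⁻¹ W ≃ W ⊆ V`
  let e : ↥(π' ⁻¹ᵁ W) ≃ₜ ↥W := Scheme.homeoOfIso (asIso (π' ∣_ W))
  let φ₀ : ↥M'.badLocus → M.V := fun v' => ((e ⟨v'.1, hW v'⟩ : ↥W) : M.V)
  have hφ₀ : ∀ v', φ₀ v' = π'.base v'.1 := fun v' => by
    have h1 : (e ⟨v'.1, hW v'⟩ : ↥W) = (π' ∣_ W).base ⟨v'.1, hW v'⟩ := rfl
    change ((e ⟨v'.1, hW v'⟩ : ↥W) : M.V) = _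
    rw [h1]
    exact morphismRestrict_base_coe π' W ⟨v'.1, hW v'⟩
  have hind₀ : IsInducing φ₀ := by
    refine IsInducing.subtypeVal.comp (e.isInducing.comp ?_)
    exact (IsInducing.subtypeVal.codRestrict hW : IsInducing fun v' : ↥M'.badLocus => (⟨v'.1, hW v'⟩ : ↥(π' ⁻¹ᵁ W)))
  have hinj₀ : Function.Injective φ₀ := by
    intro a b hab
    have h1 : (e ⟨a.1, hW a⟩ : ↥W) = e ⟨b.1, hW b⟩ := Subtype.ext hab
    have h2 := e.injective h1
    exact Subtype.ext (congrArg (fun x : ↥(π' ⁻¹ᵁ W) => (x : M'.V)) h2)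
  have hmem₀ : ∀ v', φ₀ v' ∈ M.badLocus := fun v' => by rw [hφ₀]; exact hmem v'
  refine ⟨Set.codRestrict φ₀ M.badLocus hmem₀, ⟨hind₀.codRestrict hmem₀, (Set.injective_codRestrict hmem₀).mpr hinj₀⟩,
    fun v' => hφ₀ v', ?_⟩
  ext z
  constructor
  · rintro ⟨v', rfl⟩
    exact (e ⟨v'.1, hW v'⟩).2
  · intro hz
    -- the unique preimage of `z` over the idle region is bad
    let y : ↥W := ⟨z.1, hz⟩
    let x : ↥(π' ⁻¹ᵁ W) := e.symm y
    have hπx : π'.base x.1 = z.1 := by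
      have h1 : π'.base x.1 = ((π' ∣_ W).base x).1 := (morphismRestrict_base_coe π' W x).symm
      rw [h1]
      change ((e (e.symm y) : ↥W) : M.V) = z.1
      rw [e.apply_symm_apply]
    have hxbad : x.1 ∈ M'.badLocus := by
      intro hgood
      have hz' : π'.base x.1 ∉ ((𝒦.ideal d).support : Set M.V) := by rw [hπx]; exact hz
      exact z.2 (hπx ▸ isGoodAt_base_of_isGoodAt hG M M' 𝒦 d π' hbl hr hcomm hsuppG hz' hgood)
    refine ⟨⟨x.1, hxbad⟩, Subtype.ext ?_⟩
    change φ₀ ⟨x.1, hxbad⟩ = z.1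
    have h3 : (⟨x.1, hW ⟨x.1, hxbad⟩⟩ : ↥(π' ⁻¹ᵁ W)) = x := Subtype.ext rfl
    change ((e ⟨x.1, hW ⟨x.1, hxbad⟩⟩ : ↥W) : M.V) = z.1
    rw [h3]
    change ((e (e.symm y) : ↥W) : M.V) = z.1
    rw [e.apply_symm_apply]

/-- ★ **A PRINCIPAL MOVE THAT TOUCHES THE BAD LOCUS LOWERS THE NUMBER OF IRREDUCIBLE COMPONENTS OF THE BAD LOCUS.** [OURS · L1 W4.5c] -/
theorem nIrrComp_badLocus_principalMove_lt [Finite G] (hp : p.Prime) (hG : ∀ g : G, g ∈ Subgroup.zpowers g₀)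
    (M M' : GModel p q G ρ g₀) (𝒦 : ReesFiltration M.V) (d : ℕ) (hkill : IsPrincipalCentre p M.act g₀ 𝒦 d) (hB : M.HasNoetherianBase)
    (hfin : (irreducibleComponents ↥M.badLocus).Finite)
    (htouch : (M.badLocus ∩ ((𝒦.ideal d).support : Set M.V)).Nonempty) (hmv : M.IsMoveOf M' 𝒦 d) :
    nIrrComp ↥M'.badLocus < nIrrComp ↥M.badLocus := by
  have hB' := hB
  obtain ⟨π', hbl, -, hr, hcomm⟩ := hmv
  obtain ⟨R₀, _, _, s, _, hs⟩ := hB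
  obtain ⟨φ, hφ, -, hrange⟩ := exists_isEmbedding_badLocus_principalMove hp hG M M' 𝒦 d hkill π' hbl hr hcomm s hs
  exact nIrrComp_lt_of_isEmbedding hφ hrange (isClopen_badLocus_inter_support hp hG M hB' hkill) htouch hfin

/-- A non-terminal model covered by the kill-opens of a family of principal centres is TOUCHED by one of them. [OURS · L1 W4.5c] -/
theorem exists_touch_of_cover [Finite G] (hp : p.Prime) (hG : ∀ g : G, g ∈ Subgroup.zpowers g₀) (M : GModel p q G ρ g₀)
    (hB : M.HasNoetherianBase) (hT : ¬ M.Terminal) {ι : Type*} (𝒦 : ι → ReesFiltration M.V) {d : ℕ}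
    (hprin : ∀ i, IsPrincipalCentre p M.act g₀ (𝒦 i) d) (hcov : M.badLocus ⊆ ⋃ i, M.principalKillOpen (𝒦 i) d) :
    ∃ i, (M.badLocus ∩ (((𝒦 i).ideal d).support : Set M.V)).Nonempty := by
  have hne : M.badLocus.Nonempty := by
    rw [Set.nonempty_iff_ne_empty]
    exact fun h => hT ((terminal_iff_badLocus_eq_empty M).mpr h)
  obtain ⟨v, hv⟩ := hne
  obtain ⟨i, hvi⟩ := Set.mem_iUnion.mp (hcov hv)
  exact ⟨i, v, hv, mem_support_of_mem_badLocus_of_mem_principalKillOpen hp hG M hB (hprin i) hv hvi⟩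

/-- **Every model of a datum over a field has finitely many irreducible components of its bad locus** (it is quasi-compact). -/
theorem finite_irreducibleComponents_badLocus_of_datum {k : Type} [Field k] (f : X₁ ⟶ Spec (.of k)) [LocallyOfFiniteType f] [QuasiCompact f]
    [IsFinite q] (M : GModel p q G ρ g₀) : (irreducibleComponents ↥M.badLocus).Finite := by
  haveI := M.isProper
  have hr : M.r = M.π ≫ q := M.r_eq
  haveI : QuasiCompact (M.r ≫ f) := by rw [hr]; infer_instance
  haveI : CompactSpace M.V := (HasAffineProperty.iff_of_isAffine (P := @QuasiCompact)).mp ‹QuasiCompact (M.r ≫ f)›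
  exact M.finite_irreducibleComponents_badLocus

/-! ## The winning-strategy induction for the sequential rule with the TOUCH kill branch -/

/-- ★★ **THE SEQUENTIAL RULE WITH THE TOUCH-KILL BRANCH WINS** (lexicographic induction on `(jInf, n, nIrrComp badLocus)`): let `P` be a class of models
stable under admissible moves, with Noetherian bases, finite `ν₁` and finitely many bad components; if at every non-terminal `P`-model EITHER some
PRINCIPAL centre TOUCHES the bad locus (`(badLocus ∩ supp 𝒦_d).Nonempty` — then `jInf` does not increase by `jInf_move_le`, p612119, and the component
count drops), OR `AuxAltWithin n M` holds for some `n`, then every `P`-model WINS. [OURS · L1 W4.5c] -/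
theorem wins_of_killTouchOrAuxSeq [Finite G] (hp : p.Prime) (hG : ∀ g : G, g ∈ Subgroup.zpowers g₀) (P : GModel p q G ρ g₀ → Prop)
    (hPmove : ∀ (M M' : GModel p q G ρ g₀) (𝒦 : ReesFiltration M.V) (d : ℕ),
      P M → IsAdmissibleCentre p M.act g₀ 𝒦 d → M.IsMoveOf M' 𝒦 d → P M')
    (hB : ∀ M : GModel p q G ρ g₀, P M → M.HasNoetherianBase) (hnu : ∀ M : GModel p q G ρ g₀, P M → ∃ n : ℕ, M.nu1 < n)
    (hfin : ∀ M : GModel p q G ρ g₀, P M → (irreducibleComponents ↥M.badLocus).Finite)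
    (H : ∀ M : GModel p q G ρ g₀, P M → ¬ M.Terminal →
      (∃ (𝒦 : ReesFiltration M.V) (d : ℕ), IsPrincipalCentre p M.act g₀ 𝒦 d ∧
        (M.badLocus ∩ ((𝒦.ideal d).support : Set M.V)).Nonempty) ∨
      (∃ n : ℕ, AuxAltWithin n M))
    (M₀ : GModel p q G ρ g₀) (hP₀ : P M₀) : Wins p q G ρ g₀ M₀ := by
  obtain ⟨n₀, hn₀⟩ := hnu M₀ hP₀
  suffices main : ∀ (a : ℕ) (M : GModel p q G ρ g₀), P M → M.jInf < a → Wins p q G ρ g₀ M from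
    main n₀ M₀ hP₀ (lt_of_le_of_lt M₀.jInf_le_nu1 hn₀)
  intro a
  induction a using Nat.strong_induction_on with
  | _ a iha =>
    -- strict `jInf` drops are handled by the outer hypothesis
    have drop : ∀ M M' : GModel p q G ρ g₀, P M' → M.jInf < a → M'.jInf < M.jInf → Wins p q G ρ g₀ M' := fun M M' hP' ha hj => by
      cases a with
      | zero => exact absurd (withBot_eq_bot_of_lt_zero ha ▸ hj) not_lt_bot
      | succ a' => exact iha a' (Nat.lt_succ_self a') M' hP' (lt_of_lt_of_le hj (withBot_le_of_lt_succ ha))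
    -- bounded AUX sequences, by induction on their length
    have seq : ∀ (n : ℕ) (M : GModel p q G ρ g₀), P M → M.jInf < a → AuxAltWithin n M → Wins p q G ρ g₀ M := by
      intro n
      induction n with
      | zero =>
        intro M hPM ha h
        obtain ⟨𝒦, d, haux, hmoves⟩ := h
        exact Wins.of_moves 𝒦 d haux.1 fun M' hmv => drop M M' (hPmove M M' 𝒦 d hPM haux.1 hmv) ha (hmoves M' hmv)
      | succ n ihn =>
        intro M hPM ha h
        rcases h with h | ⟨𝒦, d, haux, hmoves⟩
        · obtain ⟨𝒦, d, haux, hmoves⟩ := h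
          exact Wins.of_moves 𝒦 d haux.1 fun M' hmv => drop M M' (hPmove M M' 𝒦 d hPM haux.1 hmv) ha (hmoves M' hmv)
        · exact Wins.of_moves 𝒦 d haux.1 fun M' hmv =>
            ihn M' (hPmove M M' 𝒦 d hPM haux.1 hmv) (lt_of_le_of_lt (hmoves M' hmv).1 ha) (hmoves M' hmv).2
    -- TOUCH-KILL moves lower the number of bad components: induction on a bound for it
    have kill : ∀ (m : ℕ) (M : GModel p q G ρ g₀), P M → M.jInf < a → nIrrComp ↥M.badLocus < m → Wins p q G ρ g₀ M := by
      intro m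
      induction m with
      | zero => exact fun M _ _ hm => absurd hm (Nat.not_lt_zero _)
      | succ m ihm =>
        intro M hPM ha hm
        by_cases hT : M.Terminal
        · exact Wins.terminal M hT
        rcases H M hPM hT with ⟨𝒦, d, hprin, htouch⟩ | ⟨n, hn⟩
        · refine Wins.of_moves 𝒦 d (isAdmissibleCentre_of_isPrincipalCentre hprin) fun M' hmv => ?_
          have hPM' := hPmove M M' 𝒦 d hPM (isAdmissibleCentre_of_isPrincipalCentre hprin) hmv
          have hj : M'.jInf ≤ M.jInf := jInf_move_le hp hG M M' 𝒦 d hprin (hB M hPM) hmv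
          exact ihm M' hPM' (lt_of_le_of_lt hj ha)
            (lt_of_lt_of_le (nIrrComp_badLocus_principalMove_lt hp hG M M' 𝒦 d hprin (hB M hPM) (hfin M hPM) htouch hmv)
              (Nat.lt_succ_iff.mp hm))
        · exact seq n M hPM ha hn
    intro M hPM ha
    exact kill (nIrrComp ↥M.badLocus + 1) M hPM ha (Nat.lt_succ_self _)

end GameFrame.GModel

/-! ## The K-side research statement in TOUCH form (one connected component at a time) -/

/-- **`KillTouchReach p`** (OURS CANDIDATE research statement, asserted nowhere; the K side ONE CONNECTED COMPONENT AT A TIME): at every non-terminal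
model reachable from the initial model of a crux datum with every bad point killable (`jInf = ⊥`), SOME principal centre `(𝒦, d)` has a support that
MEETS the bad locus — by `…S1aKillClopen` its support then contains the whole connected component of `Z(M)` it meets, and by
`nIrrComp_badLocus_principalMove_lt` the move removes those components from the bad locus while `jInf` stays `⊥`. Weaker than the registered v7 stub
`KillFamilyReach p` (`killTouchReach_of_killFamilyReach`): no common Veronese degree across components, no pairwise-disjointness of supports, no
simultaneous cover. Research content left = per connected component `B` of an all-killable bad locus: ONE principal centre with `B ⊆ supp` — (K1)
compatibility of the local kills ALONG `B` and (K3) a support closed in `V` (census: support = the component). [OURS · L1 W4.5c] -/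
def KillTouchReach (p : ℕ) : Prop :=
  ∀ (k : Type) [Field k] [CharP k p] [PerfectField k] (X' X₁ : Scheme.{0})
    (f : X₁ ⟶ Spec (.of k)) (q : X' ⟶ X₁) (G : Type) [Group G] [Finite G]
    (ρ : G →* Aut X'), Nat.card G = p → IsSeparated f → LocallyOfFiniteType f → QuasiCompact f →
    IsIntegral X₁ → ∀ [IsIntegral X'], Scheme.IsRegular X' → IsFinite q → Function.Surjective q.base →
    (∃ U : X₁.Opens, Dense (U : Set X₁) ∧ Etale (q ∣_ U)) →
    ∀ (hq : ∀ g : G, (ρ g).hom ≫ q = q),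
    (∀ x y : X', q.base x = q.base y → ∃ g : G, (ρ g).hom.base x = y) →
    topologicalKrullDim X₁ ≤ 4 → Function.Injective ρ →
    ∀ (g₀ : G), (∀ g : G, g ∈ Subgroup.zpowers g₀) → ∀ [IsLocallyNoetherian X']
      (h₀ : NodeAtlas p (⟨ρ, hq⟩ : ActionOver q G) g₀),
      ∀ M : GameFrame.GModel p q G ρ g₀, (GameFrame.GModel.initial hq h₀).Reachable M → ¬ M.Terminal → M.jInf = ⊥ →
        ∃ (𝒦 : ReesFiltration M.V) (d : ℕ), IsPrincipalCentre p M.act g₀ 𝒦 d ∧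
          (M.badLocus ∩ ((𝒦.ideal d).support : Set M.V)).Nonempty

/-- **The registered v7 stub implies the touch form**: `KillFamilyReach p ⇒ KillTouchReach p`. [OURS · L1 W4.5c] -/
theorem killTouchReach_of_killFamilyReach {p : ℕ} (hp : p.Prime) (h : KillFamilyReach p) : KillTouchReach p := by
  intro k _ _ _ X' X₁ f q G _ _ ρ hG hfs hfft hfqc hX₁ _ hreg hqfin hqs hqet hq horb hdim hinj g₀ hg₀ _ h₀ M hR hT hj
  haveI := hfft
  haveI := hqfin
  obtain ⟨n, 𝒦, d, -, hprin, -, hcov⟩ :=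
    h k X' X₁ f q G ρ hG hfs hfft hfqc hX₁ hreg hqfin hqs hqet hq horb hdim hinj g₀ hg₀ h₀ M hR hT hj
  obtain ⟨i, hi⟩ := GameFrame.GModel.exists_touch_of_cover hp hg₀ M (GameFrame.GModel.hasNoetherianBase_of_datum f M) hT 𝒦 hprin hcov
  exact ⟨𝒦 i, d, hprin i, hi⟩

/-- **The one-centre support form implies the touch form** at the level of research statements: if at every reachable all-killable model some principal
centre has `badLocus ⊆ supp 𝒦_d`, then `KillTouchReach p`. [OURS · L1 W4.5c] -/
theorem killTouchReach_of_support {p : ℕ}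
    (h : ∀ (k : Type) [Field k] [CharP k p] [PerfectField k] (X' X₁ : Scheme.{0})
      (f : X₁ ⟶ Spec (.of k)) (q : X' ⟶ X₁) (G : Type) [Group G] [Finite G]
      (ρ : G →* Aut X'), Nat.card G = p → IsSeparated f → LocallyOfFiniteType f → QuasiCompact f →
      IsIntegral X₁ → ∀ [IsIntegral X'], Scheme.IsRegular X' → IsFinite q → Function.Surjective q.base →
      (∃ U : X₁.Opens, Dense (U : Set X₁) ∧ Etale (q ∣_ U)) →
      ∀ (hq : ∀ g : G, (ρ g).hom ≫ q = q),
      (∀ x y : X', q.base x = q.base y → ∃ g : G, (ρ g).hom.base x = y) →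
      topologicalKrullDim X₁ ≤ 4 → Function.Injective ρ →
      ∀ (g₀ : G), (∀ g : G, g ∈ Subgroup.zpowers g₀) → ∀ [IsLocallyNoetherian X']
        (h₀ : NodeAtlas p (⟨ρ, hq⟩ : ActionOver q G) g₀),
        ∀ M : GameFrame.GModel p q G ρ g₀, (GameFrame.GModel.initial hq h₀).Reachable M → ¬ M.Terminal → M.jInf = ⊥ →
          ∃ (𝒦 : ReesFiltration M.V) (d : ℕ), IsPrincipalCentre p M.act g₀ 𝒦 d ∧ M.badLocus ⊆ ((𝒦.ideal d).support : Set M.V)) :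
    KillTouchReach p := by
  intro k _ _ _ X' X₁ f q G _ _ ρ hG hfs hfft hfqc hX₁ _ hreg hqfin hqs hqet hq horb hdim hinj g₀ hg₀ _ h₀ M hR hT hj
  obtain ⟨𝒦, d, hprin, hsub⟩ := h k X' X₁ f q G ρ hG hfs hfft hfqc hX₁ hreg hqfin hqs hqet hq horb hdim hinj g₀ hg₀ h₀ M hR hT hj
  have hne : M.badLocus.Nonempty := by
    rw [Set.nonempty_iff_ne_empty]
    exact fun h' => hT ((GameFrame.GModel.terminal_iff_badLocus_eq_empty M).mpr h')
  obtain ⟨v, hv⟩ := hne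
  exact ⟨𝒦, d, hprin, v, hv, hsub hv⟩

end Summit.ResolutionOfSingularities.ResolutionOfSingularities.Theorems.WildQuotientResolution.S1

end
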